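import Mathlib
import Literature.Probability.Distributions.NoncentralChiSquaredTwoMGF
import HarnessLib

/-!
# Frugal rejection sampling at slice fraction `φ` has EXACTLY the depolarized score law (Laplace transforms)

Topic `Literature/Computability/QuantumComplexity`; a sibling of
`CertifiedRandomnessRestrictedAdversary.lean` / `CertifiedRandomnessOracleModelEAT.lean` (the
deployers' restricted-adversary and oracle-model vocabulary).  Theorems only (no definitions, no
named facts).

**The printed model and claim.** Liu, Niroula, DeCross, … , Shaydulin, *Certified randomness
amplification by dynamically probing remote random quantum states*, arXiv:2511.03686v1 (2025),
Supplementary Information §VIII.C "Frugal rejection sampling classical adversary" (PDF pp. 243–245):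
"We consider the following classical simulation algorithm and show it behaves similar to sampling from
a depolarized quantum state."  Contracting a fraction `φ` of the slices of the tensor network and
frugally rejection-sampling from the resulting `|ψ_S⟩`, the ideal probability of the returned string is
modelled as (VIII.24)
`p_ψ(x) = φ p_S(x) + (1−φ) p_⊥(x) + 2√(φ(1−φ)) R √(p_S(x) p_⊥(x))` with independent
`PDF_{p_S}(t) = N² t e^{−Nt}` (VIII.25), `PDF_{p_⊥}(t) = N e^{−Nt}` (VIII.26), `R = cos ϑ`, `ϑ` uniform
on `(−π, π]` (VIII.27); the depolarized law of fidelity `φ` has `PDF(t) = φ N² t e^{−Nt} + (1−φ) N e^{−Nt}`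
(VIII.28).  The SI supports "(VIII.24) ≈ (VIII.28)" NUMERICALLY (Fig. 15: "the Monte-Carlo approach is a
faithful representation of frugal rejection sampling … This similarly applies to sampling from the
depolarized state").

**What is proved here (exact, inside the printed model).**  In units of `N·p` — known score
`T = N p_S ∼ Gamma(2,1)`, complement score `U = N p_⊥ ∼ Exp(1)`, phase `ϑ` — the score of (VIII.24)
is `X = φT + (1−φ)U + 2√(φ(1−φ)TU) cos ϑ`, and for every `φ ∈ [0,1]` and `θ < 1`

  `E[e^{θX}] = ∫_0^∞ (∫∫ e^{θ(φt + (1−φ)u + 2√(φ(1−φ)tu) cos ϑ)} dUnif(ϑ) dExp(u)) · t e^{−t} dt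
            = (1−φ)/(1−θ) + φ/(1−θ)²`                                  (`frugalSampling_mgf_eq_depolarized`)

which is EXACTLY the Laplace transform of the depolarized law (VIII.28) in the same units,
`∫_0^∞ e^{θx} (φ x e^{−x} + (1−φ) e^{−x}) dx = (1−φ)/(1−θ) + φ/(1−θ)²`  (`depolarized_mgf`).
So, on `θ < 1`, the two Laplace transforms coincide identically (`frugalSampling_mgf_eq_depolarized_mgf`):
inside the model (VIII.24)–(VIII.27) the frugal-rejection-sampling score law IS the depolarized law
(VIII.28) — by uniqueness of the Laplace transform on an open interval, a textbook step NOT formalised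
here; the file asserts only the equality of the transforms.  The conditional transform given `T = t`
is the non-central `χ²₂` Laplace transform `kernelMGF_selectionRound` of the sibling Literature file;
the `t`-average is the Gamma integral `∫_0^∞ t e^{−rt} dt = r⁻²`.

(Cell qa-cr context: this is the classical-round hypothesis of the deployers' entropy theorems —
Liu et al. 2025 SM Lemma 2 / Liu et al. 2025b SI Lemma 37 take classical rounds to be (close to) the
depolarized family — verified EXACTLY for the frugal class in the printed model, in contrast with the
`K`-sample selection class of the qa-cr line `selection-law-laplace`, whose transform has `K+1` simple
poles and is not of this form.  HONEST FRAMING: a statement inside the deployers' named statistical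
model; no computational assumption; it analyses a published adversary MODEL as a law, contains no
algorithm, and does not bear on BQP vs BPP.)
-/

noncomputable section

namespace Literature.Computability.QuantumComplexity

open MeasureTheory ProbabilityTheory Set Real
open Literature.Probability.Distributions (kernelMGF_selectionRound)

/-- The Gamma(2) Laplace integral: `∫_0^∞ t e^{−rt} dt = 1/r²` for `r > 0`. [folklore] -/
private theorem integral_mul_exp_neg_mul_Ioi {r : ℝ} (hr : 0 < r) :
    ∫ t in Ioi (0 : ℝ), t * exp (-(r * t)) = 1 / r ^ 2 := by
  have h := Real.integral_rpow_mul_exp_neg_mul_Ioi (a := 2) (by norm_num) hr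
  have h2 : Real.Gamma 2 = 1 := by
    rw [show (2 : ℝ) = (1 : ℕ) + 1 by norm_num, Real.Gamma_nat_eq_factorial]
    simp
  rw [h2, mul_one, show (2 : ℝ) - 1 = 1 by norm_num] at h
  simp_rw [Real.rpow_one] at h
  rw [h, show (2 : ℝ) = ((2 : ℕ) : ℝ) by norm_num, Real.rpow_natCast, one_div, inv_pow, one_div]

/-- **The `t`-average of the conditional transform**: with `B = 1 − (1−φ)θ`,
`∫_0^∞ B⁻¹ e^{φtθ/B} · t e^{−t} dt = (1−φ)/(1−θ) + φ/(1−θ)²` for `φ ∈ [0,1]`, `θ < 1`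
(`= B/(1−θ)²`; the exponent rate is `r = (1−θ)/B > 0`).
[cite: LiuEtAl2025CertifiedRandomnessAmplification, SI §VIII.C eqs. (VIII.24)–(VIII.28)] -/
theorem integral_kernelMGF_gammaTwo (φ θ : ℝ) (hφ : φ ∈ Icc (0 : ℝ) 1) (hθ : θ < 1) :
    ∫ t in Ioi (0 : ℝ),
        ((1 - (1 - φ) * θ)⁻¹ * exp (φ * t * θ / (1 - (1 - φ) * θ))) * (t * exp (-t))
      = (1 - φ) / (1 - θ) + φ / (1 - θ) ^ 2 := by
  obtain ⟨hφ0, hφ1⟩ := hφ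
  -- `B = 1 − (1−φ)θ > 0`
  have hB : 0 < 1 - (1 - φ) * θ := by
    rcases le_or_gt 0 θ with h | h
    · nlinarith
    · nlinarith
  have hBne : (1 - (1 - φ) * θ) ≠ 0 := hB.ne'
  have h1θ : 0 < 1 - θ := by linarith
  -- the rate `r = (1 − θ)/B`
  set r : ℝ := (1 - θ) / (1 - (1 - φ) * θ) with hr
  have hrpos : 0 < r := div_pos h1θ hB
  have hexp : ∀ t : ℝ, exp (φ * t * θ / (1 - (1 - φ) * θ)) * (t * exp (-t)) = t * exp (-(r * t)) := by
    intro t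
    rw [mul_comm (exp _) (t * exp (-t)), mul_assoc, ← exp_add]
    congr 2
    rw [hr, add_comm, div_add' _ _ _ hBne,
      show -((1 - θ) / (1 - (1 - φ) * θ) * t) = (-((1 - θ) * t)) / (1 - (1 - φ) * θ) by ring,
      div_left_inj' hBne]
    ring
  have hpt : ∀ t : ℝ, ((1 - (1 - φ) * θ)⁻¹ * exp (φ * t * θ / (1 - (1 - φ) * θ))) * (t * exp (-t))
      = (1 - (1 - φ) * θ)⁻¹ * (t * exp (-(r * t))) := by
    intro t
    rw [mul_assoc, hexp t]
  simp_rw [hpt]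
  rw [integral_const_mul, integral_mul_exp_neg_mul_Ioi hrpos, hr]
  have h1θne : (1 - θ) ≠ 0 := h1θ.ne'
  field_simp
  ring

/-- **Frugal rejection sampling has exactly the depolarized Laplace transform.**  In the model
(VIII.24)–(VIII.27) of Liu et al. 2025b SI §VIII.C — known score `T = N p_S ∼ Gamma(2,1)` (density
`t e^{−t}`), complement `U = N p_⊥ ∼ Exp(1)`, uniform phase `ϑ` (the score depends on `cos ϑ` only, so
`ϑ` is taken uniform on `(0, π]`), score `X = φT + (1−φ)U + 2√(φ(1−φ)TU) cos ϑ` — one has for every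
slice fraction `φ ∈ [0,1]` and every `θ < 1`:
`E[e^{θX}] = (1 − φ)/(1 − θ) + φ/(1 − θ)²`, the Laplace transform of the fidelity-`φ` depolarized law
(VIII.28) (`depolarized_mgf`).  The SI shows the agreement of the two laws numerically (Fig. 15); this
is the exact statement at the level of Laplace transforms.
[cite: LiuEtAl2025CertifiedRandomnessAmplification, SI §VIII.C eqs. (VIII.24)–(VIII.28), Fig. 15] -/
theorem frugalSampling_mgf_eq_depolarized (φ θ : ℝ) (hφ : φ ∈ Icc (0 : ℝ) 1) (hθ : θ < 1) :
    ∫ t in Ioi (0 : ℝ),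
        (∫ u, ∫ ϑ, exp (θ * (φ * t + (1 - φ) * u + 2 * sqrt (φ * (1 - φ) * t * u) * cos ϑ))
            ∂(cond volume (Ioc 0 π)) ∂(expMeasure 1)) * (t * exp (-t))
      = (1 - φ) / (1 - θ) + φ / (1 - θ) ^ 2 := by
  rw [setIntegral_congr_fun measurableSet_Ioi (fun t (ht : t ∈ Ioi (0 : ℝ)) => by
    rw [kernelMGF_selectionRound φ t θ hφ (le_of_lt ht) hθ])]
  exact integral_kernelMGF_gammaTwo φ θ hφ hθ

/-- **The Laplace transform of the depolarized law** (VIII.28) in units of `N·p`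
(`φ·Gamma(2,1) + (1−φ)·Exp(1)`, density `φ x e^{−x} + (1−φ) e^{−x}` on `(0, ∞)`):
`∫_0^∞ e^{θx}(φ x e^{−x} + (1−φ) e^{−x}) dx = (1−φ)/(1−θ) + φ/(1−θ)²`, `θ < 1`.
[cite: LiuEtAl2025CertifiedRandomnessAmplification, SI §VIII.C eq. (VIII.28)] -/
theorem depolarized_mgf (φ θ : ℝ) (hθ : θ < 1) :
    ∫ x in Ioi (0 : ℝ), exp (θ * x) * (φ * (x * exp (-x)) + (1 - φ) * exp (-x))
      = (1 - φ) / (1 - θ) + φ / (1 - θ) ^ 2 := by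
  have h1θ : 0 < 1 - θ := by linarith
  have hpt : ∀ x : ℝ, exp (θ * x) * (φ * (x * exp (-x)) + (1 - φ) * exp (-x))
      = φ * (x * exp (-((1 - θ) * x))) + (1 - φ) * exp ((θ - 1) * x) := by
    intro x
    have e1 : exp (θ * x) * exp (-x) = exp ((θ - 1) * x) := by
      rw [← exp_add]; congr 1; ring
    have e2 : exp (θ * x) * (x * exp (-x)) = x * exp (-((1 - θ) * x)) := by
      rw [show -((1 - θ) * x) = (θ - 1) * x by ring, ← e1]; ring
    calc exp (θ * x) * (φ * (x * exp (-x)) + (1 - φ) * exp (-x))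
        = φ * (exp (θ * x) * (x * exp (-x))) + (1 - φ) * (exp (θ * x) * exp (-x)) := by ring
      _ = φ * (x * exp (-((1 - θ) * x))) + (1 - φ) * exp ((θ - 1) * x) := by rw [e1, e2]
  simp_rw [hpt]
  have hi1 : IntegrableOn (fun x : ℝ => x * exp (-((1 - θ) * x))) (Ioi 0) := by
    have h := Real.GammaIntegral_convergent (s := 2) (by norm_num)
    have h' : IntegrableOn (fun x : ℝ => exp (-x) * x ^ ((2 : ℝ) - 1)) (Ioi 0) := h
    -- rescale `x ↦ (1−θ)x` is avoided: use the closed form to certify integrability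
    refine Integrable.of_integral_ne_zero ?_
    rw [integral_mul_exp_neg_mul_Ioi h1θ]
    positivity
  have hi2 : IntegrableOn (fun x : ℝ => exp ((θ - 1) * x)) (Ioi 0) :=
    integrableOn_exp_mul_Ioi (by linarith) 0
  rw [integral_add (hi1.const_mul φ) (hi2.const_mul (1 - φ)), integral_const_mul, integral_const_mul,
    integral_mul_exp_neg_mul_Ioi h1θ, integral_exp_mul_Ioi (by linarith) 0]
  have h1θne : (1 - θ) ≠ 0 := h1θ.ne'
  have h2 : θ - 1 ≠ 0 := by intro h; apply h1θne; linarith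
  rw [mul_zero, exp_zero]
  field_simp
  ring

/-- **The two Laplace transforms coincide on `θ < 1`** (frugal rejection sampling at slice fraction
`φ` vs the fidelity-`φ` depolarized law, both in units of `N·p`).
[cite: LiuEtAl2025CertifiedRandomnessAmplification, SI §VIII.C eqs. (VIII.24)–(VIII.28), Fig. 15] -/
theorem frugalSampling_mgf_eq_depolarized_mgf (φ θ : ℝ) (hφ : φ ∈ Icc (0 : ℝ) 1) (hθ : θ < 1) :
    ∫ t in Ioi (0 : ℝ),
        (∫ u, ∫ ϑ, exp (θ * (φ * t + (1 - φ) * u + 2 * sqrt (φ * (1 - φ) * t * u) * cos ϑ))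
            ∂(cond volume (Ioc 0 π)) ∂(expMeasure 1)) * (t * exp (-t))
      = ∫ x in Ioi (0 : ℝ), exp (θ * x) * (φ * (x * exp (-x)) + (1 - φ) * exp (-x)) := by
  rw [frugalSampling_mgf_eq_depolarized φ θ hφ hθ, depolarized_mgf φ θ hθ]

end Literature.Computability.QuantumComplexity

end
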